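import Literature.Barriers.ResolutionOfSingularities.LocalMonomializationFailsProofs
import Literature.Barriers.ResolutionOfSingularities.LocalMonomializationFailsLemmaNotMonomial
import Literature.Barriers.ResolutionOfSingularities.LocalMonomializationFailsPersistProofs
import Literature.AlgebraicGeometry.Resolution.QuadraticTransformsFactorization
import Literature.AlgebraicGeometry.Resolution.QuadraticTransformsProofs
import HarnessLib

/-!
# Discharge of the named fact `Cutkosky2014` (Cutkosky's counterexample to local monomialization)

`Literature/Barriers/ResolutionOfSingularities/LocalMonomializationFailsHolds.lean` — the closed
discharge `Cutkosky2014_holds : Cutkosky2014` of the barrier fact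
`Literature.Barriers.ResolutionOfSingularities.Cutkosky.Cutkosky2014` (Cutkosky, "Counterexamples
to local monomialization in positive characteristic", Math. Ann. 362 (2015) 321–334, Thm. 1.4;
file `LocalMonomializationFails.lean`). It feeds the conditional assembly
`Cutkosky2014_of_facts` (`LocalMonomializationFailsProofs.lean`, which proves everything of §3 of
the paper from four named ingredients) with the four discharges now in the tree:

* `AbhyankarQuadraticFactorization_holds` — Cutkosky Thm. 2.1 = Abhyankar (1956) Thm. 3
  (`Literature/AlgebraicGeometry/Resolution/QuadraticTransformsFactorization.lean`);
* `AbhyankarQuadraticUnion_holds` — Cutkosky Lemma 2.2 = Abhyankar (1956) Lemma 12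
  (`Literature/AlgebraicGeometry/Resolution/QuadraticTransformsProofs.lean`);
* `CutkoskyLemma31_holds` — Cutkosky Lemma 3.1
  (`LocalMonomializationFailsLemmaNotMonomial.lean`, with `…LemmaShape`, `…LemmaBlock`,
  `…LemmaUnits`, `…LemmaSeries`);
* `CutkoskyMonomialPersists_holds` — Cutkosky §3 p. 7 (`LocalMonomializationFailsPersistProofs.lean`).

[cite: Cutkosky2014, Thm. 1.4]
-/

namespace Literature.Barriers.ResolutionOfSingularities

namespace Cutkosky

/-- **Cutkosky's counterexample to local and weak local monomialization in positive
characteristic, PROVED** (Thm. 1.4, as the named fact `Cutkosky2014`): for every field `k` of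
characteristic `p > 0` with at least three elements and every `n ≥ 2` there are a finite
separable extension `K*/K` of `n`-dimensional function fields over `k`, a valuation ring of `K*`
and algebraic regular local rings `A` of `K`, `B` of `K*` (`B` dominating `A`, the valuation
dominating `B`) admitting no weak local monomialization. Proof: `Cutkosky2014_of_facts` applied
to the four discharged ingredients (see the module docstring). [cite: Cutkosky2014, Thm. 1.4] -/
theorem Cutkosky2014_holds : Cutkosky2014 :=
  Cutkosky2014_of_facts Literature.AlgebraicGeometry.Resolution.AbhyankarQuadraticFactorization_holds
    Literature.AlgebraicGeometry.Resolution.AbhyankarQuadraticUnion_holds CutkoskyLemma31_holds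
    CutkoskyMonomialPersists_holds

end Cutkosky

end Literature.Barriers.ResolutionOfSingularities
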